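import Summits.FinalStateConjecture.FinalStateConjecture.Theses.PhaseMixingCapture
import Literature.Geometry.Lorentzian.StabilityCauchy

/-!
# First-lemma file — crux-ideate round 2, ideator 5 — crux `PhaseMixingCapture.CaptureSufficesC2`
# (item stmt-FinalStateConjecture-14986) — card `the-pin-is-printed`

Everything here ELABORATES (no `sorry`); the two `theorem`s are proved. Nothing is a stub of a line
(no skeleton at the ideation stage); the `def … : Prop`s are the SIGNATURES the card refers to:

* `collarBackground M a r₁` — the TWO-SIDED (horizon-straddling) ingoing Kerr–Schild reference
  background `{r > max r₁ 0} = Kerr.region a r₁`, `r₁ ∈ (r₋, r₊)`: the region on which the printed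
  small-spin / sub-extremal stability theorems actually conclude (Klainerman–Szeftel arXiv:2104.11857,
  §2.2.2: `𝓜_int` is foliated down to `𝓐 = {r = r₊(1 − δ_𝓗)}`, decay norms `𝔇_k = sup_{𝓜_int} ū^{1+δ_dec}
  |𝔡^{≤k}Γ|`, §3.3.3; Hintz arXiv:2606.28253, (1.2): `Ω = {r ≥ m₀, t̃ ≥ 0}`, `m₀ ∈ (r⁻_b, r⁺_b)`), as
  opposed to the one-sided `Kerr.background M a` (`{r > r₊}`) of the tree's consequence-form renderings.
* `CollarConvergesToKerr 𝒟 M a r₁ k` — ORIENTED two-sided `Cᵏ` convergence: a late chart on the collar,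
  smooth, an open embedding of `{t* > τ₀}`, with image in `J⁺(ι X)` (kills the time-reversed witness
  `Negative/ReversedKerrChart`, p99879) and full-slab `Cᵏ` deviation `→ 0` on the TWO-SIDED slabs
  `{t* = τ, r > r₁}` (kills the under/over-shooting witnesses `Ψ_{±h}` of B2 at order `k ≥ 1`: the true
  event horizon lies INSIDE the chart, cf. KS §3 "Existence of a future event horizon … 𝓗₊ is actually
  located in the interior of the region 𝓜_int").
* `PinnedKerrConvergence` — verbatim the dead line's `StrongKerrConvergence` (Lines/Sketch.lean §1, l. 287):
  the horizon-normalised, future-exhaustive one-sided chart the summit's `HasExhaustiveCharts` consumes.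
* `CollarPinning` — the card's NEW GEOMETRIC STUB (pure Lorentzian geometry of ONE development, no PDE):
  oriented two-sided `C³` convergence on a collar ⇒ pinned exhaustive `C²` convergence (bounded-orbit lemma
  at `C³` + transition-map bookkeeping; the derivative count of TRIAGE-r1-3: "k = 3 if two-sided").
* `KSCollarFact` — the SIGNATURE of the re-vendoring the card files as a cite item: Klainerman–Szeftel's
  Main Theorem in Cauchy consequence form with (a) the collar conclusion, (b) the convergence order handed
  over (`∀ K` up front: `k_small = ⌊k_large/2⌋ + 1`, `k_large` a free large parameter, KS (3.4.8) and p. 51),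
  (c) orientation. It is NOT asserted here (named-fact shape only, D-0014).
-/

set_option linter.dupNamespace false

noncomputable section

namespace Summit.FinalStateConjecture.FinalStateConjecture.Cruxes.CaptureSufficesC2.Ideator5

open Set Filter Function Topology
open scoped Manifold ContDiff ENNReal
open Literature.Geometry.Lorentzian

/-- The **two-sided Kerr–Schild collar background** `(Kerr.region a r₁, g_{M,a}, t* = x⁰, r)`:
for `r₁ ∈ (r₋, r₊)` its domain straddles the future event horizon `{r = r₊}` (ingoing Kerr–Schild
coordinates are regular across it). Klainerman–Szeftel arXiv:2104.11857 §2.2.2 (`𝓜_int` down to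
`r₊(1 − δ_𝓗)`); Hintz arXiv:2606.28253 (1.2) (`Ω = {r ≥ m₀}`). [cite: KlainermanSzeftel2023, §2.2.2] -/
def collarBackground (M a r₁ : ℝ) : ModelBackground where
  domain := Kerr.region a r₁
  bilin := Kerr.bilin M a
  time x := x 0
  radius := Kerr.radius a

/-- The collar contains the exterior when `r₁ ≤ r₊` (so a collar chart restricts to an exterior chart). -/
theorem exterior_le_collar_domain {M a r₁ : ℝ} (h : r₁ ≤ Kerr.rPlus M a) :
    Kerr.exterior M a ≤ (collarBackground M a r₁).domain :=
  Kerr.region_mono a h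

/-- The collar's reference form is the exterior background's form (same Kerr–Schild components). -/
theorem collarBackground_bilin (M a r₁ : ℝ) :
    (collarBackground M a r₁).bilin = (Kerr.background M a).bilin := rfl

/-- **Oriented two-sided `Cᵏ` convergence to Kerr `(M, a)` on the collar `{r > r₁}`** of a Cauchy
development `𝒟 = (𝓜, g, τ, ι, ν)`: a late time `τ₀` and a collar chart `Ψ`, smooth, an open embedding
of `{t* > τ₀, r > r₁}`, FUTURE-ORIENTED (`Ψ{t* > τ₀} ⊆ J⁺(ι X)`), with full two-sided-slab `Cᵏ` deviation
`Ψ^*g − g_{M,a} → 0`. Consequence form of KS arXiv:2104.11857 Main Theorem (3.4.8) read on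
`𝓜_int ∪ 𝓜_ext` / Hintz arXiv:2606.28253 Thm 1.1 on `Ω`. [cite: KlainermanSzeftel2023, (3.4.8)] -/
def CollarConvergesToKerr {X : Type} [TopologicalSpace X] [ChartedSpace E3 X] [IsManifold (𝓡 3) ∞ X]
    [ConnectedSpace X] {D : InitialDataSet (𝓡 3) X} (𝒟 : CauchyDevelopment D) (M a r₁ : ℝ) (k : ℕ) :
    Prop :=
  ∃ (τ₀ : ℝ) (Ψ : (collarBackground M a r₁).domain → 𝒟.carrier),
    ContMDiff 𝓘(ℝ, E4) (𝓡 4) ∞ Ψ ∧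
    Topology.IsOpenEmbedding (((collarBackground M a r₁).lateRegion τ₀).restrict Ψ) ∧
    Ψ '' (collarBackground M a r₁).lateRegion τ₀ ⊆ 𝒟.metric.causalFuture 𝒟.timeOrientation (range 𝒟.embed) ∧
    Tendsto (fun τ ↦ 𝒟.toSpacetime.deviationCk (collarBackground M a r₁) Ψ k τ) atTop (𝓝 0)

/-- **Pinned (horizon-normalised, future-exhaustive) `Cᵏ` convergence** — VERBATIM the dead line's
`StrongKerrConvergence` (Cruxes/CaptureSufficesC2/Lines/Sketch.lean §1): the package the landed bookkeeping
`stub_softShieldedDecomposition_bookkeeping` (p99862) turns into the summit's `N = 1` exhaustive decomposition.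
[folklore] -/
def PinnedKerrConvergence {X : Type} [TopologicalSpace X] [ChartedSpace E3 X] [IsManifold (𝓡 3) ∞ X]
    [ConnectedSpace X] {D : InitialDataSet (𝓡 3) X} (𝒟 : CauchyDevelopment D) (M a : ℝ) (k : ℕ) : Prop :=
  ∃ (τ₀ : ℝ) (Ψ : (Kerr.background M a).domain → 𝒟.carrier),
    ContMDiff 𝓘(ℝ, E4) (𝓡 4) ∞ Ψ ∧
    Topology.IsOpenEmbedding ((Kerr.lateRegion M a τ₀).restrict Ψ) ∧
    Ψ '' Kerr.lateRegion M a τ₀ ⊆ 𝒟.metric.causalFuture 𝒟.timeOrientation (range 𝒟.embed) ∧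
    Tendsto (fun τ ↦ 𝒟.toSpacetime.deviationCk (Kerr.background M a) Ψ k τ) atTop (𝓝 0) ∧
    ∀ τ₁ : ℝ, τ₀ ≤ τ₁ →
      Summit.FinalStateConjecture.exteriorOf 𝒟 (Ψ '' Kerr.lateRegion M a τ₀) \
          Ψ '' Kerr.lateRegion M a τ₁ ⊆
        𝒟.metric.causalPast 𝒟.timeOrientation (Ψ '' Kerr.timeSlab M a τ₁)

/-- **THE CARD'S NEW STUB (signature): collar pinning.** For a SUB-extremal `(M, a)` (so `κ > 0`) and an
inner radius `r₁ < r₊(M, a)`, oriented two-sided `C³` convergence on the collar implies pinned exhaustive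
`C²` convergence. Content (card §Lever): (i) in the collar chart the outgoing null congruence near `{r = r₊}`
obeys `ṙ = κ(r − r₊) + f`, `‖f‖_{C²} → 0` iff the metric deviation `→ 0` in `C³`; its unique bounded orbit
is the TRUE event horizon of `𝒟` inside the image (KS §3, "Existence of a future event horizon"), a graph
`r = r₊ + h(t*, ω)` with `h → 0` in `C³` (method of characteristics: `h` is exactly as regular as the
deviation); (ii) re-anchoring `Ψ' := Ψ ∘ G`, `G(t*, r, ω) = (t*, r + χ(r)h(t*, ω), ω)` gives an exterior chart
with `C²` deviation `≲ ‖e‖_{C²}(1 + ‖G‖_{C³}) + ‖G^*g_K − g_K‖_{C²} → 0` — the ONE extra derivative the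
two-sided rendering supplies and the one-sided `k = 2` item does not (TRIAGE-r1-3 (a)–(b)); (iii) exhaustion
at every chart time: chart-exterior points flow to later slabs along the (perturbed) ZAMO field, interior
image points never re-enter (null hypersurface, one-way), image boundary = initial slab ∪ horizon. Pure
Lorentzian geometry of one development (M–L); no strip estimate, no wall data. [folklore] -/
def CollarPinning : Prop :=
  ∀ (X : Type) [TopologicalSpace X] [ChartedSpace E3 X] [IsManifold (𝓡 3) ∞ X] [ConnectedSpace X]
    (D : InitialDataSet (𝓡 3) X) (𝒟 : CauchyDevelopment D) (M a r₁ : ℝ),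
    Kerr.IsSubextremal M a → r₁ < Kerr.rPlus M a →
      CollarConvergesToKerr 𝒟 M a r₁ 3 → PinnedKerrConvergence 𝒟 M a 2

/-- **SIGNATURE of the proposed re-vendoring (cite item; NOT asserted): Klainerman–Szeftel (+ GKS, Shen),
Cauchy consequence form WITH THE COLLAR.** Versus the tree's `klainerman_szeftel_kerr_stability_small_a_cauchy`
(StabilityCauchy.lean: `∃ (s δ k)`, one-sided `ConvergesToKerr 𝒟oc`, unoriented): (a) the convergence ORDER is
handed over — `∀ K` up front (KS p. 51: `k_large ≫ 1/δ_dec` is a free large parameter, `k_small = ⌊k_large/2⌋ + 1`,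
conclusion (3.4.8) `𝔑^{(Dec)}_{k_small} ≤ Cε₀`); (b) the conclusion chart lives on a COLLAR `{r > r₁}`,
`r₁ ∈ (r₋(M′,a′), r₊(M′,a′))` (KS §2.2.2: `𝓜_int` reaches `𝓐 = {r = r₊(1 − δ_𝓗)}`; §8.4.1: in `(ū, r, x¹, x²)`
coordinates `g = g_{a∞,m∞} + O(ε₀/ū^{1+δ_dec})` on `𝓜_int`); (c) ORIENTED (the theorem is about the FUTURE
development `𝓜_∞`). Modulus rendered qualitatively (`∀ η ∃ ε`, as the C2 items). [cite: KlainermanSzeftel2023, Main Theorem §3.4.3, (3.4.8); §2.2.2; §8.4] -/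
def KSCollarFact [Kerr.Facts] [Kerr.SliceFacts] : Prop :=
  ∀ K : ℕ, ∃ (s : ℕ) (δ : ℝ), ∃ a₀ > (0 : ℝ), ∀ (M a : ℝ) (hM : 0 < M), |a| < a₀ * M →
    ∀ r₀ ∈ Set.Ioo (Kerr.rMinus M a) (Kerr.rPlus M a), ∀ η > (0 : ℝ), ∃ ε > (0 : ℝ),
      ∀ (D : InitialDataSet 𝓘(ℝ, E3) (Kerr.slice a r₀)) [D.metric.HasLeviCivita],
        D.IsVacuumConstraintSolution →
        InitialDataSet.dataWeightedSobolevEDist s δ D (Kerr.data M a r₀ hM.le) < ENNReal.ofReal ε →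
        ∀ 𝒟 : VacuumCauchyDevelopment D, 𝒟.IsMaximal →
          ∃ (M' a' r₁ : ℝ), Kerr.IsSubextremal M' a' ∧ Kerr.rMinus M' a' < r₁ ∧ r₁ < Kerr.rPlus M' a' ∧
            𝒟.HasCompleteFutureNullInfinityFar ∧
            CollarConvergesToKerr 𝒟.toCauchyDevelopment M' a' r₁ K ∧
            |M' - M| + |a' - a| ≤ η

/-- Sanity (trivial bookkeeping, PROVED): a collar fact at every order gives the order the pinning stub eats. -/
theorem ksCollarFact_three [Kerr.Facts] [Kerr.SliceFacts] (h : KSCollarFact) :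
    ∃ (s : ℕ) (δ : ℝ), ∃ a₀ > (0 : ℝ), ∀ (M a : ℝ) (hM : 0 < M), |a| < a₀ * M →
      ∀ r₀ ∈ Set.Ioo (Kerr.rMinus M a) (Kerr.rPlus M a), ∀ η > (0 : ℝ), ∃ ε > (0 : ℝ),
        ∀ (D : InitialDataSet 𝓘(ℝ, E3) (Kerr.slice a r₀)) [D.metric.HasLeviCivita],
          D.IsVacuumConstraintSolution →
          InitialDataSet.dataWeightedSobolevEDist s δ D (Kerr.data M a r₀ hM.le) < ENNReal.ofReal ε →
          ∀ 𝒟 : VacuumCauchyDevelopment D, 𝒟.IsMaximal →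
            ∃ (M' a' r₁ : ℝ), Kerr.IsSubextremal M' a' ∧ Kerr.rMinus M' a' < r₁ ∧ r₁ < Kerr.rPlus M' a' ∧
              𝒟.HasCompleteFutureNullInfinityFar ∧
              CollarConvergesToKerr 𝒟.toCauchyDevelopment M' a' r₁ 3 ∧
              |M' - M| + |a' - a| ≤ η :=
  h 3

/-- **What the two stubs give together, inside ONE development (PROVED bookkeeping):** collar fact at order 3
+ collar pinning ⇒ the PINNED package `PinnedKerrConvergence … 2` (= `StrongKerrConvergence`, the exact
hypothesis shape of the dead line's G_line `stub_softShieldedStrongCapture`) for every MGHD of near-Kerr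
leaf data — i.e. the un-vendored half of the printed conclusion, recovered WITHOUT an owner restatement of
item 14985 and WITHOUT a causal pinning clause in the vendored text. -/
theorem pinned_of_collarFact_of_pinning [Kerr.Facts] [Kerr.SliceFacts]
    (hF : KSCollarFact) (hP : CollarPinning) :
    ∃ (s : ℕ) (δ : ℝ), ∃ a₀ > (0 : ℝ), ∀ (M a : ℝ) (hM : 0 < M), |a| < a₀ * M →
      ∀ r₀ ∈ Set.Ioo (Kerr.rMinus M a) (Kerr.rPlus M a), ∀ η > (0 : ℝ), ∃ ε > (0 : ℝ),
        ∀ (D : InitialDataSet 𝓘(ℝ, E3) (Kerr.slice a r₀)) [D.metric.HasLeviCivita],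
          D.IsVacuumConstraintSolution →
          InitialDataSet.dataWeightedSobolevEDist s δ D (Kerr.data M a r₀ hM.le) < ENNReal.ofReal ε →
          ∀ 𝒟 : VacuumCauchyDevelopment D, 𝒟.IsMaximal →
            ∃ (M' a' : ℝ), Kerr.IsSubextremal M' a' ∧ 𝒟.HasCompleteFutureNullInfinityFar ∧
              PinnedKerrConvergence 𝒟.toCauchyDevelopment M' a' 2 ∧ |M' - M| + |a' - a| ≤ η := by
  obtain ⟨s, δ, a₀, ha₀, H⟩ := hF 3
  refine ⟨s, δ, a₀, ha₀, fun M a hM ha r₀ hr₀ η hη ↦ ?_⟩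
  obtain ⟨ε, hε, Hε⟩ := H M a hM ha r₀ hr₀ η hη
  refine ⟨ε, hε, fun D _ hvac hdist 𝒟 hmax ↦ ?_⟩
  obtain ⟨M', a', r₁, hsub, -, hr₁, hfar, hcol, hmod⟩ := Hε D hvac hdist 𝒟 hmax
  exact ⟨M', a', hsub, hfar, hP _ _ 𝒟.toCauchyDevelopment M' a' r₁ hsub hr₁ hcol, hmod⟩

end Summit.FinalStateConjecture.FinalStateConjecture.Cruxes.CaptureSufficesC2.Ideator5

end
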